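import Literature.NumberTheory.Sieve.BombieriAsymptoticSieveLemma11
import Literature.NumberTheory.Sieve.BombieriAsymptoticSieveLemma12
import Literature.NumberTheory.Sieve.SieveFrameworkFundamentalLemma
import HarnessLib

/-!
# Bombieri's asymptotic sieve, rank-uniform form: Lemmata 11 and 12 uniformly in `k`

Topic `Literature/NumberTheory/Sieve`, companion ("Proofs") file of `BombieriAsymptoticSieve.lean`,
`BombieriAsymptoticSieveLemma11.lean`, `BombieriAsymptoticSieveLemma12.lean` and
`BombieriAsymptoticSieveRankUniform.lean`. Source: J. Friedlander, H. Iwaniec, *On Bombieri's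
asymptotic sieve*, Ann. Scuola Norm. Sup. Pisa Cl. Sci. (4) **5** (1978) 719–756
[FriedlanderIwaniecPisa1978], Lemmata 11–12 (p. 738) and their rank-uniform counterparts
Lemmata 25–26 (§§7–8, pp. 751–753). Everything here is PROVED (theorems only).

The tree's named facts `FI1978_lemma11`, `FI1978_lemma12` (discharged in
`BombieriAsymptoticSieveProofs.lean`) quantify `∃ C` AFTER `∀ k`, which is all that Theorem 1 needs.
For the rank-uniform Corollary (Theorem 2) the constants and thresholds must not depend on `k`.
Inspection of the tree's proofs shows that they do not, except at two places in Lemma 12: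
the constant `C = C_F C₇ C₈ + 1 + k C₇ C₈ + C₉` is linear in `k` (from
`∑ a_n (log n)^b = A(x)(log x)^b(1 + O(b β(x)))`, exactly the `a β(X)` of Lemma 26), and (A₂) was
invoked with `B = k + 1` to absorb the remainder term conveniently. Here the SAME proofs are
re-run with the quantifiers `∃ C ∀ ε ∀ᶠ x ∀ k` and, in Lemma 12, with the fixed `B = 3` and the
threshold `x ≥ x₀(ε, s)` replaced by the explicit side condition `e^s ≤ c₀(ε) log x`
(FI absorb `c(ε)/log x` into `e^{−s}` in the same way):

* `FI1978_lemma11_uniform` — `∃ C ∀ ε>0 ∀ᶠ x ∀ k ∀ y z`, (`zy < x`, `z√x < y < x^{1−ε}`):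
  `|Σ₂| ≤ C A(x)(log x/y)^{k+1}(log z)^{−2}` (cf. Lemma 25);
* `FI1978_lemma12_uniform` — `∃ η>0 ∃ C ∀ ε>0 ∃ c₀>0 ∀ᶠ x ∀ k ≥ 2 ∀ s ≥ 2` with `e^s ≤ c₀ log x`,
  `∀ y z` (`z ≥ 2`, `y ≥ 1`, `z^s y ≤ x^{1−ε}`):
  `|Σ₁ − H A(x) F| ≤ C k (e^{−s} A(x) L^{k−1} + (∫₁^x A(t)dt/t) L^{k−2} + z^{−η} A(x) L^k)(L/log z)²`
  (cf. Lemma 26: `(e^{−s} + aβ(X)) 2^a … (log X/log z)²`).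

Both are proved from the fundamental lemma (`SieveSequence.fundamental_lemma_uniform_holds`) by the
proofs of `BombieriSieve.FI1978_lemma11_of_fundamentalLemma` and
`BombieriSieve.FI1978_lemma12_of_fundamentalLemma`, copied with the stated modifications.
No new definitions; no named facts.
-/

noncomputable section

open Filter Finset
open scoped Topology

namespace Literature.NumberTheory.Sieve

namespace BombieriSieve

open scoped ArithmeticFunction.Moebius
open MeasureTheory

/-! ### Lemma 11, uniformly in `k` -/

/-- **[FriedlanderIwaniecPisa1978] Lemma 11 with `k`-uniform constant and threshold** (the scalar
case of Lemma 25), from the fundamental lemma: the proof of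
`FI1978_lemma11_of_fundamentalLemma` verbatim, `k` being introduced after `x` — its constant
`(1 + C_F) C₇ C₈ + 1` and its threshold `log x ≥ max(1, C₂(ε, 3))` never depended on `k`.
[cite: FriedlanderIwaniecPisa1978, Lemma 11 and Lemma 25] -/
theorem FI1978_lemma11_uniform_of_fundamentalLemma (hFL : SieveSequence.fundamental_lemma_uniform)
    (A : SieveSequence) (hA : A.IsBombieriSequence) :
    ∃ C : ℝ, ∀ ε : ℝ, 0 < ε → ∀ᶠ x : ℝ in atTop, ∀ k : ℕ, ∀ y z : ℝ, 2 ≤ z → z * y < x →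
      z * Real.sqrt x < y → y < x ^ (1 - ε) →
        |BombieriSieve.sigma2 A k x y z| ≤
          C * A.size x * Real.log (x / y) ^ (k + 1) / Real.log z ^ 2 := by
  have hsize := hA.1
  have hA0 : ∀ x, 0 ≤ A.size x := SieveSequence.size_nonneg_of_size_eq hsize
  rcases density_nonneg_or_size_eq_zero A hA with hg | hzero
  swap
  · -- degenerate case: all `a_n` vanish, `Σ₂ = 0`
    refine ⟨0, fun ε hε => Filter.Eventually.of_forall fun x k y z _ _ _ _ => ?_⟩
    have h0 : ∑ n ∈ Ioc 0 ⌊x⌋₊, A.a n = 0 := by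
      have := hzero x
      rwa [hsize x, SieveSequence.congrSum,
        Finset.filter_true_of_mem (fun n _ => one_dvd n)] at this
    have ha : ∀ n ∈ Ioc 0 ⌊x⌋₊, A.a n = 0 :=
      (Finset.sum_eq_zero_iff_of_nonneg fun n _ => A.a_nonneg n).mp h0
    have hs : sigma2 A k x y z = 0 := by
      rw [sigma2]
      exact Finset.sum_eq_zero fun n hn => by rw [ha n (Finset.mem_filter.mp hn).1, mul_zero]
    rw [hs, abs_zero]
    simp
  -- the constants: sieve dimension, fundamental lemma, Lemma 7, Lemma 8
  obtain ⟨K, hK⟩ := hasSieveDimension A hA hg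
  obtain ⟨CF, hCF0, hFL'⟩ := hFL 1 K
  obtain ⟨H, -, -, η, -, C₇, h7⟩ := FI1978_lemma7_rat A hA
  obtain ⟨C₈, h8⟩ := FI1978_lemma8_rat A hA.2.1 hA.2.2.2.2.2
  set C₇' := max C₇ 1 with hC₇'
  set C₈' := max C₈ 1 with hC₈'
  have hC₇'0 : 0 ≤ C₇' := zero_le_one.trans (le_max_right _ _)
  have hC₈'0 : 0 ≤ C₈' := zero_le_one.trans (le_max_right _ _)
  refine ⟨(1 + CF) * C₇' * C₈' + 1, fun ε hε => ?_⟩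
  -- (A₂) with this `ε` and `B = 3`
  obtain ⟨C₂, hC₂⟩ := hA.2.2.1 ε hε ((3 : ℕ) : ℝ) (by norm_num)
  filter_upwards [hC₂, eventually_ge_atTop (1 : ℝ),
    Real.tendsto_log_atTop.eventually_ge_atTop (max 1 C₂)] with x hx2 hx1 hxlog k y z hz hzy hzx hyx
  -- the parameters
  have hx0 : 0 < x := by linarith
  have hlogx1 : 1 ≤ Real.log x := (le_max_left _ _).trans hxlog
  have hC₂log : C₂ ≤ Real.log x := (le_max_right _ _).trans hxlog
  have hz0 : 0 < z := by linarith
  have hz1 : 1 < z := by linarith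
  have hsqrt1 : 1 ≤ Real.sqrt x := by
    rw [← Real.sqrt_one]
    exact Real.sqrt_le_sqrt hx1
  have hsqrt0 : 0 < Real.sqrt x := by linarith
  have hy2 : 2 ≤ y := by nlinarith
  have hy0 : 0 < y := by linarith
  have hy1 : 1 ≤ y := by linarith
  have hyx' : y ≤ x := by
    refine hyx.le.trans ?_
    calc x ^ (1 - ε) ≤ x ^ (1 : ℝ) := Real.rpow_le_rpow_of_exponent_le hx1 (by linarith)
      _ = x := Real.rpow_one x
  have hzxy : z < x / y := by rwa [lt_div_iff₀ hy0]
  have hxy0 : 0 ≤ x / y := div_nonneg hx0.le hy0.le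
  have hzx' : z ≤ x := hzxy.le.trans (div_le_self hx0.le hy1)
  have hlogz : 0 < Real.log z := Real.log_pos hz1
  have hlogxy : Real.log z ≤ Real.log (x / y) := Real.log_le_log hz0 hzxy.le
  have hlogxy0 : 0 < Real.log (x / y) := hlogz.trans_le hlogxy
  have hlogzx : Real.log z ≤ Real.log x := Real.log_le_log hz0 hzx'
  -- the level: `z² · x/y < z √x < y < x^{1−ε}`
  have hlevel : x / y * z ^ 2 < x ^ (1 - ε) := by
    have h1 : x / y * z ^ 2 < z * Real.sqrt x := by
      rw [div_mul_eq_mul_div, div_lt_iff₀ hy0]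
      have hsx : Real.sqrt x ^ 2 = x := Real.sq_sqrt hx0.le
      have h2 : Real.sqrt x * z < y := by linarith
      calc x * z ^ 2 = (Real.sqrt x * z) * (z * Real.sqrt x) := by
            linear_combination (-(z ^ 2)) * hsx
        _ < y * (z * Real.sqrt x) := mul_lt_mul_of_pos_right h2 (mul_pos hz0 hsqrt0)
        _ = z * Real.sqrt x * y := by ring
    exact h1.trans (hzx.trans hyx)
  set P := primesProdBelow z with hP
  set V := A.densityProduct P with hV
  have hVle : V ≤ C₇' / Real.log z :=
    (h7 z hz).2.trans (div_le_div_of_nonneg_right (le_max_left _ _) hlogz.le)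
  have hV0 : 0 ≤ V := by
    rw [hV, densityProduct_primesProdBelow]
    exact Finset.prod_nonneg fun p hp =>
      (sub_pos.mpr (hA.2.1.2 p (Nat.prime_of_mem_primesBelow hp).one_lt)).le
  have hAx := hA0 x
  -- Step 1: `|Σ₂| ≤ (log x/y)^k ∑_m S(𝒜_m, z; x)`
  have h1 := abs_sigma2_le A k z hy0 hyx'
  rw [← hP] at h1
  -- Step 2: the fundamental lemma (upper half) for each `𝒜_m`, `(m, P(z)) = 1`, at level `z²`
  have hFLm : ∀ m ∈ (Ioc 0 ⌊x / y⌋₊).filter (fun m : ℕ => m.Coprime P),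
      (A.restrictDvd m).sifted x P ≤ (1 + CF) * A.size x * V * |A.density m| +
        ∑ d ∈ P.divisors.filter (fun d : ℕ => (d : ℝ) ≤ z ^ 2), |A.remainder (m * d) x| := by
    intro m hm
    obtain ⟨hm', hmP⟩ := Finset.mem_filter.mp hm
    have hm1 : 1 ≤ m := (Finset.mem_Ioc.mp hm').1
    have hgm : 0 ≤ A.density m := hg m hm1
    have hsz : 0 ≤ A.density m * A.size x := mul_nonneg hgm hAx
    have hzz : z ≤ z ^ 2 := by nlinarith
    have h : |(A.restrictDvd m).sifted x P - A.density m * A.size x * V| ≤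
        CF * (A.density m * A.size x) * V * Real.exp (-(Real.log (z ^ 2) / Real.log z)) +
          ∑ d ∈ P.divisors.filter (fun d : ℕ => (d : ℝ) ≤ z ^ 2),
            |(A.restrictDvd m).remainder d x| :=
      hFL' (A.restrictDvd m) hK x z (z ^ 2) hz hzz hsz
    have hrem : ∑ d ∈ P.divisors.filter (fun d : ℕ => (d : ℝ) ≤ z ^ 2),
        |(A.restrictDvd m).remainder d x| =
        ∑ d ∈ P.divisors.filter (fun d : ℕ => (d : ℝ) ≤ z ^ 2), |A.remainder (m * d) x| := by
      refine Finset.sum_congr rfl fun d hd => ?_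
      have hdP : d ∣ P := Nat.dvd_of_mem_divisors (Finset.mem_filter.mp hd).1
      rw [remainder_restrictDvd A (hmP.coprime_dvd_right hdP)]
    rw [hrem] at h
    have hexp : Real.exp (-(Real.log (z ^ 2) / Real.log z)) ≤ 1 := by
      rw [Real.exp_le_one_iff, neg_nonpos]
      exact div_nonneg (Real.log_nonneg (by nlinarith)) hlogz.le
    have hup := (abs_sub_le_iff.mp h).1
    have hgAV : 0 ≤ CF * (A.density m * A.size x) * V := mul_nonneg (mul_nonneg hCF0.le hsz) hV0
    have hmain : A.density m * A.size x * V +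
        CF * (A.density m * A.size x) * V * Real.exp (-(Real.log (z ^ 2) / Real.log z)) ≤
        (1 + CF) * A.size x * V * |A.density m| := by
      rw [abs_of_nonneg hgm]
      calc A.density m * A.size x * V +
            CF * (A.density m * A.size x) * V * Real.exp (-(Real.log (z ^ 2) / Real.log z))
          ≤ A.density m * A.size x * V + CF * (A.density m * A.size x) * V * 1 := by
            gcongr
        _ = (1 + CF) * A.size x * V * A.density m := by ring
    linarith
  -- Step 3: summing over `m`: Lemma 8 for the main terms, rearrangement + (A₂) for the remainders
  have h8' : ∑ m ∈ (Ioc 0 ⌊x / y⌋₊).filter (fun m : ℕ => m.Coprime P), |A.density m| ≤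
      C₈' * Real.log (x / y) / Real.log z := by
    refine (h8 (x / y) z hz hzxy.le).trans ?_
    exact div_le_div_of_nonneg_right (mul_le_mul_of_nonneg_right (le_max_left _ _) hlogxy0.le)
      hlogz.le
  have hR : ∑ m ∈ (Ioc 0 ⌊x / y⌋₊).filter (fun m : ℕ => m.Coprime P),
      ∑ d ∈ P.divisors.filter (fun d : ℕ => (d : ℝ) ≤ z ^ 2), |A.remainder (m * d) x| ≤
      C₂ * A.size x / Real.log x ^ 3 := by
    have hM : ∀ m ∈ (Ioc 0 ⌊x / y⌋₊).filter (fun m : ℕ => m.Coprime P), m ≠ 0 ∧ m.Coprime P :=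
      fun m hm => ⟨(Finset.mem_Ioc.mp (Finset.mem_filter.mp hm).1).1.ne',
        (Finset.mem_filter.mp hm).2⟩
    have hL : ∀ m ∈ (Ioc 0 ⌊x / y⌋₊).filter (fun m : ℕ => m.Coprime P),
        (m : ℝ) * z ^ 2 < x ^ (1 - ε) := by
      intro m hm
      have hmX : (m : ℝ) ≤ x / y :=
        (Nat.cast_le.mpr (Finset.mem_Ioc.mp (Finset.mem_filter.mp hm).1).2).trans
          (Nat.floor_le hxy0)
      exact (mul_le_mul_of_nonneg_right hmX (sq_nonneg z)).trans_lt hlevel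
    have hre := sum_coprime_sum_divisors_le (primesProdBelow_ne_zero z)
      (fun q => |A.remainder q x|) (fun q => abs_nonneg _) _ hM (z ^ 2) (x ^ (1 - ε)) hL
    refine hre.trans ?_
    have := hx2 (fun _ => x) fun _ => le_rfl
    rwa [Real.rpow_natCast] at this
  have hsumS : ∑ m ∈ (Ioc 0 ⌊x / y⌋₊).filter (fun m : ℕ => m.Coprime P),
      (A.restrictDvd m).sifted x P ≤
      (1 + CF) * A.size x * V * (C₈' * Real.log (x / y) / Real.log z) +
        C₂ * A.size x / Real.log x ^ 3 := by
    refine (Finset.sum_le_sum hFLm).trans ?_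
    rw [Finset.sum_add_distrib, ← Finset.mul_sum]
    refine add_le_add (mul_le_mul_of_nonneg_left h8' ?_) hR
    exact mul_nonneg (mul_nonneg (by linarith) hAx) hV0
  -- Step 4: arithmetic
  have hT1 : (1 + CF) * A.size x * V * (C₈' * Real.log (x / y) / Real.log z) ≤
      (1 + CF) * C₇' * C₈' * A.size x * Real.log (x / y) / Real.log z ^ 2 := by
    have hnn : 0 ≤ (1 + CF) * A.size x * (C₈' * Real.log (x / y) / Real.log z) :=
      mul_nonneg (mul_nonneg (by linarith) hAx)
        (div_nonneg (mul_nonneg hC₈'0 hlogxy0.le) hlogz.le)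
    calc (1 + CF) * A.size x * V * (C₈' * Real.log (x / y) / Real.log z)
        = (1 + CF) * A.size x * (C₈' * Real.log (x / y) / Real.log z) * V := by ring
      _ ≤ (1 + CF) * A.size x * (C₈' * Real.log (x / y) / Real.log z) * (C₇' / Real.log z) :=
          mul_le_mul_of_nonneg_left hVle hnn
      _ = (1 + CF) * C₇' * C₈' * A.size x * Real.log (x / y) / Real.log z ^ 2 := by
          field_simp
  have hT2 : C₂ * A.size x / Real.log x ^ 3 ≤ A.size x * Real.log (x / y) / Real.log z ^ 2 := by
    have hlx0 : 0 < Real.log x := by linarith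
    have ha : C₂ / Real.log x ^ 3 ≤ 1 / Real.log x := by
      rw [div_le_div_iff₀ (pow_pos hlx0 3) hlx0]
      have : C₂ * Real.log x ≤ Real.log x * Real.log x := mul_le_mul_of_nonneg_right hC₂log hlx0.le
      nlinarith
    have hb : 1 / Real.log x ≤ 1 / Real.log z := one_div_le_one_div_of_le hlogz hlogzx
    have hc : 1 / Real.log z ≤ Real.log (x / y) / Real.log z ^ 2 := by
      rw [div_le_div_iff₀ hlogz (pow_pos hlogz 2), one_mul, pow_two]
      exact mul_le_mul_of_nonneg_right hlogxy hlogz.le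
    calc C₂ * A.size x / Real.log x ^ 3 = A.size x * (C₂ / Real.log x ^ 3) := by ring
      _ ≤ A.size x * (Real.log (x / y) / Real.log z ^ 2) :=
          mul_le_mul_of_nonneg_left (ha.trans (hb.trans hc)) hAx
      _ = A.size x * Real.log (x / y) / Real.log z ^ 2 := by ring
  calc |sigma2 A k x y z|
      ≤ Real.log (x / y) ^ k * ∑ m ∈ (Ioc 0 ⌊x / y⌋₊).filter (fun m : ℕ => m.Coprime P),
          (A.restrictDvd m).sifted x P := h1
    _ ≤ Real.log (x / y) ^ k * ((1 + CF) * C₇' * C₈' * A.size x * Real.log (x / y) /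
          Real.log z ^ 2 + A.size x * Real.log (x / y) / Real.log z ^ 2) :=
        mul_le_mul_of_nonneg_left (hsumS.trans (add_le_add hT1 hT2)) (pow_nonneg hlogxy0.le k)
    _ = ((1 + CF) * C₇' * C₈' + 1) * A.size x * Real.log (x / y) ^ (k + 1) / Real.log z ^ 2 := by
        ring

/-- **Lemma 11, uniformly in `k`, DISCHARGED** (fundamental lemma = `fundamental_lemma_uniform_holds`).
[cite: FriedlanderIwaniecPisa1978, Lemma 11 and Lemma 25] -/
theorem FI1978_lemma11_uniform (A : SieveSequence) (hA : A.IsBombieriSequence) :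
    ∃ C : ℝ, ∀ ε : ℝ, 0 < ε → ∀ᶠ x : ℝ in atTop, ∀ k : ℕ, ∀ y z : ℝ, 2 ≤ z → z * y < x →
      z * Real.sqrt x < y → y < x ^ (1 - ε) →
        |BombieriSieve.sigma2 A k x y z| ≤
          C * A.size x * Real.log (x / y) ^ (k + 1) / Real.log z ^ 2 :=
  FI1978_lemma11_uniform_of_fundamentalLemma SieveSequence.fundamental_lemma_uniform_holds A hA

/-! ### Lemma 12, uniformly in `k` -/

set_option maxHeartbeats 1000000 in
/-- **[FriedlanderIwaniecPisa1978] Lemma 12 with `k`-uniform constants** (the scalar case of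
Lemma 26), from the fundamental lemma: the proof of `FI1978_lemma12_of_fundamentalLemma` with
(A₂) at the fixed `B = 3`, the constant `C_F C₇ C₈ + 1 + C₇ C₈ + C₉` multiplied by `k`
(`≥ C_F C₇ C₈ + 1 + k C₇ C₈ + C₉`), and the threshold `log x ≥ 2 C₂(ε) e^s` turned into the side
condition `e^s ≤ c₀ log x`, `c₀ = (2 max(C₂(ε), 1))⁻¹`.
[cite: FriedlanderIwaniecPisa1978, Lemma 12 and Lemma 26] -/
theorem FI1978_lemma12_uniform_of_fundamentalLemma (hFL : SieveSequence.fundamental_lemma_uniform)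
    (A : SieveSequence) (H : ℝ) (hA : A.IsBombieriSequence) (hH : A.HasDensityConstant H) :
    ∃ η : ℝ, 0 < η ∧ ∃ C : ℝ, ∀ ε : ℝ, 0 < ε → ∃ c₀ : ℝ, 0 < c₀ ∧ ∀ᶠ x : ℝ in atTop,
      ∀ k : ℕ, 2 ≤ k → ∀ s : ℝ, 2 ≤ s → Real.exp s ≤ c₀ * Real.log x → ∀ y z : ℝ,
      2 ≤ z → 1 ≤ y → z ^ s * y ≤ x ^ (1 - ε) →
        |BombieriSieve.sigma1 A k x y z - H * A.size x * BombieriSieve.mainTermF k x y z| ≤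
          C * k * (Real.exp (-s) * A.size x * Real.log x ^ (k - 1) +
                (∫ t in (1 : ℝ)..x, A.size t / t) * Real.log x ^ (k - 2) +
                z ^ (-η) * A.size x * Real.log x ^ k) *
            (Real.log x / Real.log z) ^ 2 := by
  have hsize := hA.1
  have hA0 : ∀ x, 0 ≤ A.size x := SieveSequence.size_nonneg_of_size_eq hsize
  have hAsum : ∀ x : ℝ, ∑ n ∈ Ioc 0 ⌊x⌋₊, A.a n = A.size x := fun x => by
    rw [hsize x, SieveSequence.congrSum, Finset.filter_true_of_mem (fun n _ => one_dvd n)]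
  rcases density_nonneg_or_size_eq_zero A hA with hg | hzero
  swap
  · -- degenerate case: all `a_n` vanish
    refine ⟨1, one_pos, 0, fun ε hε => ⟨1, one_pos, Filter.Eventually.of_forall
      fun x k hk s hs _ y z _ _ _ => ?_⟩⟩
    have ha : ∀ n ∈ Ioc 0 ⌊x⌋₊, A.a n = 0 :=
      (Finset.sum_eq_zero_iff_of_nonneg fun n _ => A.a_nonneg n).mp ((hAsum x).trans (hzero x))
    have hs1 : sigma1 A k x y z = 0 := by
      rw [sigma1]
      exact Finset.sum_eq_zero fun n hn => by rw [ha n (Finset.mem_filter.mp hn).1, mul_zero]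
    rw [hs1, hzero x]
    simp
  -- the constants
  obtain ⟨K, hK⟩ := hasSieveDimension A hA hg
  obtain ⟨CF, hCF0, hFL'⟩ := hFL 1 K
  obtain ⟨H₇, hH₇0, hH₇, η₇, hη₇, C₇, h7⟩ := FI1978_lemma7_rat A hA
  have hHH : H = H₇ := tendsto_nhds_unique hH hH₇
  subst hHH
  obtain ⟨C₈, h8⟩ := FI1978_lemma8_rat A hA.2.1 hA.2.2.2.2.2
  obtain ⟨η, hη0, C₉, h9⟩ := FI1978_lemma9_rat A H hA hH
  set C₇' := max C₇ 0 with hC₇'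
  set C₈' := max C₈ 0 with hC₈'
  set C₉' := max C₉ 0 with hC₉'
  have hC₇'0 : 0 ≤ C₇' := le_max_right _ _
  have hC₈'0 : 0 ≤ C₈' := le_max_right _ _
  have hC₉'0 : 0 ≤ C₉' := le_max_right _ _
  refine ⟨η, hη0, CF * C₇' * C₈' + 1 + C₇' * C₈' + C₉', fun ε hε => ?_⟩
  -- (A₂) with this `ε` and the FIXED `B = 3` (uniformity in `k`)
  obtain ⟨C₂, hC₂⟩ := hA.2.2.1 ε hε ((3 : ℕ) : ℝ) (by positivity)
  set C₂' : ℝ := max C₂ 1 with hC₂'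
  have hC₂'0 : 0 < C₂' := lt_of_lt_of_le one_pos (le_max_right _ _)
  refine ⟨(2 * C₂')⁻¹, by positivity, ?_⟩
  filter_upwards [hC₂, eventually_ge_atTop (1 : ℝ),
    Real.tendsto_log_atTop.eventually_ge_atTop (1 : ℝ)]
    with x hx2 hx1 hlogx1 k hk s hs hexps y z hz hy1 hlev
  obtain ⟨j, rfl⟩ : ∃ j, k = j + 2 := ⟨k - 2, by omega⟩
  simp only [show j + 2 - 1 = j + 1 from by omega, show j + 2 - 2 = j from by omega]
  -- the parameters
  have hx0 : 0 < x := by linarith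
  have hC₂log : 2 * C₂ * Real.exp s ≤ Real.log x := by
    have h1 : Real.exp s * (2 * C₂') ≤ Real.log x :=
      calc Real.exp s * (2 * C₂') ≤ ((2 * C₂')⁻¹ * Real.log x) * (2 * C₂') :=
            mul_le_mul_of_nonneg_right hexps (by positivity)
        _ = Real.log x := by field_simp
    have h2 : 2 * C₂ * Real.exp s ≤ 2 * C₂' * Real.exp s := by
      gcongr
      exact le_max_left _ _
    linarith
  have hz0 : 0 < z := by linarith
  have hz1 : 1 < z := by linarith
  have hy0 : 0 < y := by linarith
  have hzs : z ≤ z ^ s := by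
    calc z = z ^ (1 : ℝ) := (Real.rpow_one z).symm
      _ ≤ z ^ s := Real.rpow_le_rpow_of_exponent_le hz1.le (by linarith)
  have hzs0 : 0 < z ^ s := Real.rpow_pos_of_pos hz0 s
  have hx1ε : x ^ (1 - ε) ≤ x := by
    calc x ^ (1 - ε) ≤ x ^ (1 : ℝ) := Real.rpow_le_rpow_of_exponent_le hx1 (by linarith)
      _ = x := Real.rpow_one x
  have hyx : y ≤ x := by
    have h1 : y ≤ z ^ s * y := le_mul_of_one_le_left hy0.le (hz1.le.trans hzs)
    linarith
  have hzx : z ≤ x := by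
    have h1 : z ^ s ≤ z ^ s * y := le_mul_of_one_le_right hzs0.le hy1
    linarith
  have hlogz : 0 < Real.log z := Real.log_pos hz1
  have hlogzx : Real.log z ≤ Real.log x := Real.log_le_log hz0 hzx
  have hlx0 : 0 < Real.log x := by linarith
  set N := ⌊x⌋₊ with hN
  have hNx : (N : ℝ) ≤ x := Nat.floor_le hx0.le
  set P := primesProdBelow z with hP
  set V := A.densityProduct P with hV
  set P₁ := ∏ p ∈ Nat.primesBelow ⌈z⌉₊, (1 - (p : ℝ)⁻¹) with hP₁
  set L := Real.log x with hL
  set Ax := A.size x with hAx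
  have hAx0 : 0 ≤ Ax := hA0 x
  have hV0 : 0 ≤ V := by
    rw [hV, densityProduct_primesProdBelow]
    exact Finset.prod_nonneg fun p hp =>
      (sub_pos.mpr (hA.2.1.2 p (Nat.prime_of_mem_primesBelow hp).one_lt)).le
  have hVle : V ≤ C₇' / Real.log z :=
    (h7 z hz).2.trans (div_le_div_of_nonneg_right (le_max_left _ _) hlogz.le)
  -- the auxiliary height `X₁ = max y z ≤ x` for Lemmata 8, 9
  set X₁ := max y z with hX₁
  have hzX₁ : z ≤ X₁ := le_max_right _ _
  have hX₁x : X₁ ≤ x := max_le hyx hzx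
  have hlogX₁ : Real.log X₁ ≤ L := Real.log_le_log (hz0.trans_le hzX₁) hX₁x
  set M := (Ico 1 ⌈y⌉₊).filter (fun d : ℕ => d.Coprime P) with hM
  have hmemM : ∀ {d : ℕ}, d ∈ M → (1 ≤ d ∧ (d : ℝ) < y) ∧ d.Coprime P := by
    intro d hd
    obtain ⟨hd', hdP⟩ := Finset.mem_filter.mp hd
    obtain ⟨hd1, hdy⟩ := Finset.mem_Ico.mp hd'
    exact ⟨⟨hd1, Nat.lt_ceil.mp hdy⟩, hdP⟩
  have hMsub : M ⊆ (Ioc 0 ⌊X₁⌋₊).filter (fun d : ℕ => d.Coprime P) := by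
    intro d hd
    obtain ⟨⟨hd1, hdy⟩, hdP⟩ := hmemM hd
    refine Finset.mem_filter.mpr ⟨Finset.mem_Ioc.mpr ⟨hd1, Nat.le_floor ?_⟩, hdP⟩
    exact hdy.le.trans (le_max_left _ _)
  -- Lemma 8 and Lemma 9 over `M`
  have hG : ∑ d ∈ M, |A.density d| ≤ C₈' * L / Real.log z := by
    refine (Finset.sum_le_sum_of_subset_of_nonneg hMsub fun _ _ _ => abs_nonneg _).trans ?_
    refine (h8 X₁ z hz hzX₁).trans ?_
    rw [div_le_div_iff_of_pos_right hlogz]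
    exact mul_le_mul (le_max_left _ _) hlogX₁ (Real.log_nonneg (hz1.le.trans hzX₁)) hC₈'0
  have hS9 : ∑ d ∈ M, |A.density d * V - H * P₁ / d| ≤ C₉' * z ^ (-η) * L / Real.log z := by
    refine (Finset.sum_le_sum_of_subset_of_nonneg hMsub fun _ _ _ => abs_nonneg _).trans ?_
    refine (h9 X₁ z hz hzX₁).trans ?_
    rw [div_le_div_iff_of_pos_right hlogz]
    have hzη : 0 ≤ z ^ (-η) := Real.rpow_nonneg hz0.le _
    exact mul_le_mul (mul_le_mul_of_nonneg_right (le_max_left _ _) hzη) hlogX₁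
      (Real.log_nonneg (hz1.le.trans hzX₁)) (mul_nonneg hC₉'0 hzη)
  -- the weights `φ_d`, the sums `T_d`, `W_d`, and `β`
  set w : ℕ → ℕ → ℝ := fun d n => max 0 (Real.log ((n : ℝ) / d)) ^ (j + 2) with hw
  set T : ℕ → ℝ := fun d => ∑ n ∈ Ioc 0 N, A.a n * w d n with hT
  set W : ℕ → ℝ := fun d =>
    ∑ n ∈ (Ioc 0 N).filter (fun n : ℕ => n.Coprime P ∧ d ∣ n), A.a n * w d n with hW
  set I := ∑ n ∈ Ioc 0 N, A.a n * (L - Real.log n) with hI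
  have hIeq : ∫ t in (1 : ℝ)..x, A.size t / t = I := integral_size_div_eq A hsize hx1
  have hI0 : 0 ≤ I := Finset.sum_nonneg fun n hn => by
    have hn := Finset.mem_Ioc.mp hn
    refine mul_nonneg (A.a_nonneg n) (sub_nonneg.mpr (Real.log_le_log ?_ ?_))
    · exact_mod_cast hn.1
    · exact (Nat.cast_le.mpr hn.2).trans hNx
  have hwprops : ∀ {d : ℕ}, 1 ≤ d → (∀ n, 0 ≤ w d n) ∧ Monotone (w d) ∧
      ∀ n : ℕ, d ∣ n → 1 ≤ n → w d n = Real.log ((n : ℝ) / d) ^ (j + 2) :=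
    fun hd => logWeight_props (j + 2) hd fun n => rfl
  have hwN : ∀ {d : ℕ}, 1 ≤ d → w d N ≤ L ^ (j + 2) := by
    intro d hd
    have hd0 : (0 : ℝ) < d := by exact_mod_cast hd
    refine pow_le_pow_left₀ (le_max_left _ _) (max_le hlx0.le ?_) _
    rcases Nat.eq_zero_or_pos N with hN0 | hNpos
    · rw [hN0, Nat.cast_zero, zero_div, Real.log_zero]
      exact hlx0.le
    · calc Real.log ((N : ℝ) / d) ≤ Real.log N :=
            Real.log_le_log (div_pos (by exact_mod_cast hNpos) hd0)
              (div_le_self (Nat.cast_nonneg N) (by exact_mod_cast hd))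
        _ ≤ L := Real.log_le_log (by exact_mod_cast hNpos) hNx
  -- `T_d` against `A(x) (log x/d)^k`
  have hTd : ∀ {d : ℕ}, d ∈ M →
      0 ≤ Ax * Real.log (x / d) ^ (j + 2) - T d ∧
        Ax * Real.log (x / d) ^ (j + 2) - T d ≤ (j + 2 : ℕ) * L ^ (j + 1) * I ∧
        T d ≤ Ax * L ^ (j + 2) := by
    intro d hd
    obtain ⟨⟨hd1, hdy⟩, -⟩ := hmemM hd
    have hdx : (d : ℝ) ≤ x := hdy.le.trans hyx
    have h := size_mul_pow_log_sub_weightedSum_bounds A (k := j + 2) hd1 hdx (w := w d)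
      fun n => rfl
    rw [hAsum x, show j + 2 - 1 = j + 1 from by omega] at h
    refine ⟨h.1, h.2, ?_⟩
    have hd0 : (0 : ℝ) < d := by exact_mod_cast hd1
    have hlxd : Real.log (x / d) ≤ L := by
      rw [Real.log_div hx0.ne' hd0.ne']
      linarith [Real.log_nonneg (show (1 : ℝ) ≤ d by exact_mod_cast hd1)]
    have hlxd0 : 0 ≤ Real.log (x / d) := Real.log_nonneg ((one_le_div hd0).mpr hdx)
    calc T d ≤ Ax * Real.log (x / d) ^ (j + 2) := by linarith [h.1]
      _ ≤ Ax * L ^ (j + 2) := mul_le_mul_of_nonneg_left (pow_le_pow_left₀ hlxd0 hlxd _) hAx0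
  -- the selection `m_q ≤ N` maximising `|R(m; q)|`, and (A₂)
  have hne : (Finset.range (N + 1)).Nonempty := ⟨0, by simp⟩
  choose msel hmsel using fun q : ℕ =>
    Finset.exists_max_image (Finset.range (N + 1)) (fun m : ℕ => |A.remainder q (m : ℝ)|) hne
  set Rstar : ℕ → ℝ := fun q => |A.remainder q (msel q : ℝ)| with hRstar
  have hRstar0 : ∀ q, 0 ≤ Rstar q := fun q => abs_nonneg _
  have hRle : ∀ q m : ℕ, m ≤ N → |A.remainder q (m : ℝ)| ≤ Rstar q := fun q m hm =>
    (hmsel q).2 m (Finset.mem_range.mpr (Nat.lt_succ_of_le hm))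
  have hA2 : ∑ q ∈ Ico 1 ⌈x ^ (1 - ε)⌉₊, Rstar q ≤ C₂ * Ax / L ^ 3 := by
    have h := hx2 (fun q => (msel q : ℝ)) fun q =>
      (Nat.cast_le.mpr (Nat.lt_succ_iff.mp (Finset.mem_range.mp (hmsel q).1))).trans hNx
    rwa [Real.rpow_natCast] at h
  -- Step 1: `Σ₁` over `d` first
  have hSig : sigma1 A (j + 2) x y z = ∑ d ∈ M, (μ d : ℝ) * W d := by
    rw [sigma1_eq_sum_moebius_mul]
  -- Step 2: the sieve bound for each `d ∈ M`
  have hWd : ∀ {d : ℕ}, d ∈ M → |W d - A.density d * T d * V| ≤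
      CF * Real.exp (-s) * V * Ax * L ^ (j + 2) * |A.density d| +
        2 * L ^ (j + 2) * ∑ ν ∈ P.divisors.filter (fun ν : ℕ => (ν : ℝ) ≤ z ^ s),
          Rstar (d * ν) := by
    intro d hd
    obtain ⟨⟨hd1, hdy⟩, hdP⟩ := hmemM hd
    have hgd : 0 ≤ A.density d := hg d hd1
    obtain ⟨hw0, hwmono, -⟩ := hwprops hd1
    have h := weighted_sifted_sub_le hFL' A hK hw0 hgd hdP x (z ^ s) hz hzs
    have hexp : Real.exp (-(Real.log (z ^ s) / Real.log z)) = Real.exp (-s) := by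
      rw [Real.log_rpow hz0, mul_div_assoc, div_self hlogz.ne', mul_one]
    rw [hexp] at h
    -- the remainders
    have hrem : ∀ ν ∈ P.divisors.filter (fun ν : ℕ => (ν : ℝ) ≤ z ^ s),
        |(∑ n ∈ (Ioc 0 N).filter (fun n : ℕ => d * ν ∣ n), A.a n * w d n) -
            A.density (d * ν) * ∑ n ∈ Ioc 0 N, A.a n * w d n| ≤
          2 * L ^ (j + 2) * Rstar (d * ν) := by
      intro ν hν
      refine (abs_weighted_congrSum_sub_le A hsize hw0 hwmono (d * ν) N
        (fun m hm => hRle (d * ν) m hm)).trans ?_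
      calc 2 * Rstar (d * ν) * w d N ≤ 2 * Rstar (d * ν) * L ^ (j + 2) :=
            mul_le_mul_of_nonneg_left (hwN hd1) (mul_nonneg zero_le_two (hRstar0 _))
        _ = 2 * L ^ (j + 2) * Rstar (d * ν) := by ring
    have hmain : CF * (A.density d * T d) * V * Real.exp (-s) ≤
        CF * Real.exp (-s) * V * Ax * L ^ (j + 2) * |A.density d| := by
      rw [abs_of_nonneg hgd]
      have hT3 := (hTd hd).2.2
      calc CF * (A.density d * T d) * V * Real.exp (-s)
          = (CF * Real.exp (-s) * V * A.density d) * T d := by ring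
        _ ≤ (CF * Real.exp (-s) * V * A.density d) * (Ax * L ^ (j + 2)) :=
            mul_le_mul_of_nonneg_left hT3 (mul_nonneg (mul_nonneg (mul_nonneg hCF0.le
              (Real.exp_pos _).le) hV0) hgd)
        _ = CF * Real.exp (-s) * V * Ax * L ^ (j + 2) * A.density d := by ring
    calc |W d - A.density d * T d * V|
        ≤ CF * (A.density d * T d) * V * Real.exp (-s) +
            ∑ ν ∈ P.divisors.filter (fun ν : ℕ => (ν : ℝ) ≤ z ^ s),
              |(∑ n ∈ (Ioc 0 N).filter (fun n : ℕ => d * ν ∣ n), A.a n * w d n) -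
                  A.density (d * ν) * ∑ n ∈ Ioc 0 N, A.a n * w d n| := h
      _ ≤ CF * Real.exp (-s) * V * Ax * L ^ (j + 2) * |A.density d| +
            ∑ ν ∈ P.divisors.filter (fun ν : ℕ => (ν : ℝ) ≤ z ^ s),
              2 * L ^ (j + 2) * Rstar (d * ν) := add_le_add hmain (Finset.sum_le_sum hrem)
      _ = _ := by rw [Finset.mul_sum]
  -- Step 3: the term-by-term bound for `Σ₁ − H A(x) F`
  have hterm : ∀ d ∈ M,
      |(μ d : ℝ) * W d - H * Ax * (P₁ * ((μ d : ℝ) / d * Real.log (x / d) ^ (j + 2)))| ≤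
        CF * Real.exp (-s) * V * Ax * L ^ (j + 2) * |A.density d| +
          2 * L ^ (j + 2) * ∑ ν ∈ P.divisors.filter (fun ν : ℕ => (ν : ℝ) ≤ z ^ s),
            Rstar (d * ν) +
          (j + 2 : ℕ) * L ^ (j + 1) * I * V * |A.density d| +
          Ax * L ^ (j + 2) * |A.density d * V - H * P₁ / d| := by
    intro d hd
    obtain ⟨⟨hd1, hdy⟩, hdP⟩ := hmemM hd
    have hgd : 0 ≤ A.density d := hg d hd1
    have hd0 : (0 : ℝ) < d := by exact_mod_cast hd1
    have hdx : (d : ℝ) ≤ x := hdy.le.trans hyx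
    have hlxd : Real.log (x / d) ≤ L := by
      rw [Real.log_div hx0.ne' hd0.ne']
      linarith [Real.log_nonneg (show (1 : ℝ) ≤ d by exact_mod_cast hd1)]
    have hlxd0 : 0 ≤ Real.log (x / d) := Real.log_nonneg ((one_le_div hd0).mpr hdx)
    obtain ⟨hT1, hT2, -⟩ := hTd hd
    have hμ : |(μ d : ℝ)| ≤ 1 := by
      rw [← Int.cast_abs]
      exact_mod_cast ArithmeticFunction.abs_moebius_le_one
    have hid : (μ d : ℝ) * W d - H * Ax * (P₁ * ((μ d : ℝ) / d * Real.log (x / d) ^ (j + 2))) =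
        (μ d : ℝ) * ((W d - A.density d * T d * V) +
          A.density d * V * (T d - Ax * Real.log (x / d) ^ (j + 2)) +
          Ax * Real.log (x / d) ^ (j + 2) * (A.density d * V - H * P₁ / d)) := by ring
    rw [hid, abs_mul]
    refine (mul_le_of_le_one_left (abs_nonneg _) hμ).trans ?_
    refine (abs_add_three _ _ _).trans ?_
    have h2 : |A.density d * V * (T d - Ax * Real.log (x / d) ^ (j + 2))| ≤
        (j + 2 : ℕ) * L ^ (j + 1) * I * V * |A.density d| := by
      rw [abs_of_nonneg hgd, show A.density d * V * (T d - Ax * Real.log (x / d) ^ (j + 2)) =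
        -(A.density d * V * (Ax * Real.log (x / d) ^ (j + 2) - T d)) by ring, abs_neg,
        abs_of_nonneg (mul_nonneg (mul_nonneg hgd hV0) hT1)]
      calc A.density d * V * (Ax * Real.log (x / d) ^ (j + 2) - T d)
          ≤ A.density d * V * ((j + 2 : ℕ) * L ^ (j + 1) * I) :=
            mul_le_mul_of_nonneg_left hT2 (mul_nonneg hgd hV0)
        _ = (j + 2 : ℕ) * L ^ (j + 1) * I * V * A.density d := by ring
    have h3 : |Ax * Real.log (x / d) ^ (j + 2) * (A.density d * V - H * P₁ / d)| ≤
        Ax * L ^ (j + 2) * |A.density d * V - H * P₁ / d| := by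
      rw [abs_mul, abs_of_nonneg (mul_nonneg hAx0 (pow_nonneg hlxd0 _))]
      exact mul_le_mul_of_nonneg_right
        (mul_le_mul_of_nonneg_left (pow_le_pow_left₀ hlxd0 hlxd _) hAx0) (abs_nonneg _)
    linarith [hWd hd, h2, h3]
  -- Step 4: summing over `d ∈ M`
  have hF : H * Ax * mainTermF (j + 2) x y z =
      ∑ d ∈ M, H * Ax * (P₁ * ((μ d : ℝ) / d * Real.log (x / d) ^ (j + 2))) := by
    rw [mainTermF, ← hP₁, ← hP, ← hM, Finset.mul_sum, Finset.mul_sum]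
  have hRR : ∑ d ∈ M, ∑ ν ∈ P.divisors.filter (fun ν : ℕ => (ν : ℝ) ≤ z ^ s), Rstar (d * ν) ≤
      C₂ * Ax / L ^ 3 := by
    have hM' : ∀ m ∈ M, m ≠ 0 ∧ m.Coprime P := fun m hm =>
      ⟨by have := (hmemM hm).1.1; omega, (hmemM hm).2⟩
    have hL' : ∀ m ∈ M, (m : ℝ) * z ^ s < x ^ (1 - ε) := by
      intro m hm
      have hmy := (hmemM hm).1.2
      calc (m : ℝ) * z ^ s < y * z ^ s := mul_lt_mul_of_pos_right hmy hzs0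
        _ = z ^ s * y := mul_comm _ _
        _ ≤ x ^ (1 - ε) := hlev
    exact (sum_coprime_sum_divisors_le (primesProdBelow_ne_zero z) Rstar hRstar0 M hM' (z ^ s)
      (x ^ (1 - ε)) hL').trans hA2
  have hsum : |sigma1 A (j + 2) x y z - H * Ax * mainTermF (j + 2) x y z| ≤
      CF * Real.exp (-s) * V * Ax * L ^ (j + 2) * (C₈' * L / Real.log z) +
        2 * L ^ (j + 2) * (C₂ * Ax / L ^ 3) +
        (j + 2 : ℕ) * L ^ (j + 1) * I * V * (C₈' * L / Real.log z) +
        Ax * L ^ (j + 2) * (C₉' * z ^ (-η) * L / Real.log z) := by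
    rw [hSig, hF, ← Finset.sum_sub_distrib]
    refine (Finset.abs_sum_le_sum_abs _ _).trans ?_
    refine (Finset.sum_le_sum hterm).trans ?_
    rw [Finset.sum_add_distrib, Finset.sum_add_distrib, Finset.sum_add_distrib,
      ← Finset.mul_sum, ← Finset.mul_sum, ← Finset.mul_sum, ← Finset.mul_sum]
    have hg_sum : ∑ d ∈ M, |A.density d| ≤ C₈' * L / Real.log z := hG
    have hc1 : 0 ≤ CF * Real.exp (-s) * V * Ax * L ^ (j + 2) :=
      mul_nonneg (mul_nonneg (mul_nonneg (mul_nonneg hCF0.le (Real.exp_pos _).le) hV0) hAx0)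
        (pow_nonneg hlx0.le _)
    have hc2 : 0 ≤ 2 * L ^ (j + 2) := mul_nonneg zero_le_two (pow_nonneg hlx0.le _)
    have hc3 : 0 ≤ (j + 2 : ℕ) * L ^ (j + 1) * I * V :=
      mul_nonneg (mul_nonneg (mul_nonneg (Nat.cast_nonneg _) (pow_nonneg hlx0.le _)) hI0) hV0
    have hc4 : 0 ≤ Ax * L ^ (j + 2) := mul_nonneg hAx0 (pow_nonneg hlx0.le _)
    gcongr
  -- Step 5: the final shape
  have hQ1 : 1 ≤ L / Real.log z := by rwa [le_div_iff₀ hlogz, one_mul]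
  have hQ : L / Real.log z ≤ (L / Real.log z) ^ 2 := le_self_pow₀ hQ1 two_ne_zero
  have hLj1 : 1 ≤ L ^ (j + 1) := one_le_pow₀ hlogx1
  have hes0 : 0 < Real.exp (-s) := Real.exp_pos _
  have hzη : 0 ≤ z ^ (-η) := Real.rpow_nonneg hz0.le _
  -- term 1
  have ht1 : CF * Real.exp (-s) * V * Ax * L ^ (j + 2) * (C₈' * L / Real.log z) ≤
      CF * C₇' * C₈' * (Real.exp (-s) * Ax * L ^ (j + 1)) * (L / Real.log z) ^ 2 := by
    have hnn : 0 ≤ CF * Real.exp (-s) * Ax * L ^ (j + 2) * (C₈' * L / Real.log z) :=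
      mul_nonneg (mul_nonneg (mul_nonneg (mul_nonneg hCF0.le hes0.le) hAx0)
        (pow_nonneg hlx0.le _)) (div_nonneg (mul_nonneg hC₈'0 hlx0.le) hlogz.le)
    calc CF * Real.exp (-s) * V * Ax * L ^ (j + 2) * (C₈' * L / Real.log z)
        = CF * Real.exp (-s) * Ax * L ^ (j + 2) * (C₈' * L / Real.log z) * V := by ring
      _ ≤ CF * Real.exp (-s) * Ax * L ^ (j + 2) * (C₈' * L / Real.log z) *
            (C₇' / Real.log z) := mul_le_mul_of_nonneg_left hVle hnn
      _ = CF * C₇' * C₈' * (Real.exp (-s) * Ax * L ^ (j + 1)) * (L / Real.log z) ^ 2 := by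
          field_simp
          ring
  -- term 2 (fixed `B = 3`: `2 L^{j+2} C₂ Ax / L^3 = 2C₂ Ax L^j / L ≤ e^{-s} Ax L^j ≤ e^{-s} Ax L^{j+1}`)
  have ht2 : 2 * L ^ (j + 2) * (C₂ * Ax / L ^ 3) ≤
      1 * (Real.exp (-s) * Ax * L ^ (j + 1)) * (L / Real.log z) ^ 2 := by
    have h2C : 2 * C₂ ≤ L * Real.exp (-s) := by
      have h1 : 2 * C₂ * Real.exp s * Real.exp (-s) ≤ L * Real.exp (-s) :=
        mul_le_mul_of_nonneg_right hC₂log hes0.le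
      rwa [mul_assoc, ← Real.exp_add, add_neg_cancel, Real.exp_zero, mul_one] at h1
    have hLpow : L ^ (j + 2) = L ^ j * L ^ 2 := by rw [← pow_add]
    have hLj0 : 1 ≤ L ^ j := one_le_pow₀ hlogx1
    calc 2 * L ^ (j + 2) * (C₂ * Ax / L ^ 3)
        = (2 * C₂) * Ax * L ^ j / L := by
          rw [hLpow]
          field_simp
      _ ≤ (L * Real.exp (-s)) * Ax * L ^ j / L := by gcongr
      _ = Real.exp (-s) * Ax * L ^ j := by field_simp
      _ ≤ Real.exp (-s) * Ax * L ^ (j + 1) := by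
          rw [pow_succ]
          exact mul_le_mul_of_nonneg_left (le_mul_of_one_le_right (zero_le_one.trans hLj0) hlogx1)
            (mul_nonneg hes0.le hAx0)
      _ ≤ Real.exp (-s) * Ax * L ^ (j + 1) * (L / Real.log z) ^ 2 :=
          le_mul_of_one_le_right (mul_nonneg (mul_nonneg hes0.le hAx0) (zero_le_one.trans hLj1))
            (one_le_pow₀ hQ1)
      _ = 1 * (Real.exp (-s) * Ax * L ^ (j + 1)) * (L / Real.log z) ^ 2 := by ring
  -- term 3
  have ht3 : (j + 2 : ℕ) * L ^ (j + 1) * I * V * (C₈' * L / Real.log z) ≤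
      (j + 2 : ℕ) * C₇' * C₈' * (I * L ^ j) * (L / Real.log z) ^ 2 := by
    have hnn : 0 ≤ (j + 2 : ℕ) * L ^ (j + 1) * I * (C₈' * L / Real.log z) :=
      mul_nonneg (mul_nonneg (mul_nonneg (Nat.cast_nonneg _) (pow_nonneg hlx0.le _)) hI0)
        (div_nonneg (mul_nonneg hC₈'0 hlx0.le) hlogz.le)
    calc (j + 2 : ℕ) * L ^ (j + 1) * I * V * (C₈' * L / Real.log z)
        = (j + 2 : ℕ) * L ^ (j + 1) * I * (C₈' * L / Real.log z) * V := by ring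
      _ ≤ (j + 2 : ℕ) * L ^ (j + 1) * I * (C₈' * L / Real.log z) * (C₇' / Real.log z) :=
          mul_le_mul_of_nonneg_left hVle hnn
      _ = (j + 2 : ℕ) * C₇' * C₈' * (I * L ^ j) * (L / Real.log z) ^ 2 := by
          field_simp
          ring
  -- term 4
  have ht4 : Ax * L ^ (j + 2) * (C₉' * z ^ (-η) * L / Real.log z) ≤
      C₉' * (z ^ (-η) * Ax * L ^ (j + 2)) * (L / Real.log z) ^ 2 := by
    calc Ax * L ^ (j + 2) * (C₉' * z ^ (-η) * L / Real.log z)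
        = C₉' * (z ^ (-η) * Ax * L ^ (j + 2)) * (L / Real.log z) := by ring
      _ ≤ C₉' * (z ^ (-η) * Ax * L ^ (j + 2)) * (L / Real.log z) ^ 2 :=
          mul_le_mul_of_nonneg_left hQ (mul_nonneg hC₉'0 (mul_nonneg (mul_nonneg hzη hAx0)
            (pow_nonneg hlx0.le _)))
  -- conclusion
  rw [hIeq]
  push_cast at ht3 hsum ⊢
  have hQ0 : 0 ≤ (L / Real.log z) ^ 2 := sq_nonneg _
  have hE₁0 : 0 ≤ Real.exp (-s) * Ax * L ^ (j + 1) :=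
    mul_nonneg (mul_nonneg hes0.le hAx0) (pow_nonneg hlx0.le _)
  have hE₂0 : 0 ≤ I * L ^ j := mul_nonneg hI0 (pow_nonneg hlx0.le _)
  have hE₃0 : 0 ≤ z ^ (-η) * Ax * L ^ (j + 2) :=
    mul_nonneg (mul_nonneg hzη hAx0) (pow_nonneg hlx0.le _)
  have ha0 : 0 ≤ CF * C₇' * C₈' := mul_nonneg (mul_nonneg hCF0.le hC₇'0) hC₈'0
  have hb0 : 0 ≤ ((j : ℝ) + 2) * C₇' * C₈' := mul_nonneg (mul_nonneg (by positivity) hC₇'0) hC₈'0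
  have h4 := hsum.trans (add_le_add (add_le_add (add_le_add ht1 ht2) ht3) ht4)
  clear ht1 ht2 ht3 ht4 hsum hterm hWd hF hRR hSig hTd hwN hwprops hA2 hRle hmsel
  generalize (L / Real.log z) ^ 2 = Q at hQ0 h4 ⊢
  generalize Real.exp (-s) * Ax * L ^ (j + 1) = E₁ at hE₁0 h4 ⊢
  generalize I * L ^ j = E₂ at hE₂0 h4 ⊢
  generalize z ^ (-η) * Ax * L ^ (j + 2) = E₃ at hE₃0 h4 ⊢
  generalize CF * C₇' * C₈' = a at ha0 h4 ⊢
  generalize hbdef : ((j : ℝ) + 2) * C₇' * C₈' = b at hb0 h4 ⊢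
  have hid : (a + 1 + b + C₉') * (E₁ + E₂ + E₃) * Q -
      (a * E₁ * Q + 1 * E₁ * Q + b * E₂ * Q + C₉' * E₃ * Q) =
      Q * (a * (E₂ + E₃) + (E₂ + E₃) + b * (E₁ + E₃) + C₉' * (E₁ + E₂)) := by ring
  have h0 : 0 ≤ Q * (a * (E₂ + E₃) + (E₂ + E₃) + b * (E₁ + E₃) + C₉' * (E₁ + E₂)) :=
    mul_nonneg hQ0 (add_nonneg (add_nonneg (add_nonneg (mul_nonneg ha0 (add_nonneg hE₂0 hE₃0))
      (add_nonneg hE₂0 hE₃0)) (mul_nonneg hb0 (add_nonneg hE₁0 hE₃0)))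
      (mul_nonneg hC₉'0 (add_nonneg hE₁0 hE₂0)))
  have h5 : |sigma1 A (j + 2) x y z - H * Ax * mainTermF (j + 2) x y z| ≤
      (a + 1 + b + C₉') * (E₁ + E₂ + E₃) * Q := by linarith only [h4, hid, h0]
  refine h5.trans ?_
  have hS0 : 0 ≤ (E₁ + E₂ + E₃) * Q := mul_nonneg (add_nonneg (add_nonneg hE₁0 hE₂0) hE₃0) hQ0
  have hcc0 : 0 ≤ C₇' * C₈' := mul_nonneg hC₇'0 hC₈'0
  have hj0 : (0 : ℝ) ≤ j := Nat.cast_nonneg j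
  -- `a + 1 + b + C₉' ≤ (a + 1 + C₇'C₈' + C₉') (j + 2)` with `b = (j+2) C₇' C₈'`
  have hconst : a + 1 + b + C₉' ≤ (a + 1 + C₇' * C₈' + C₉') * ((j : ℝ) + 2) := by
    rw [← hbdef]
    have hx' : 0 ≤ (a + 1 + C₉') * ((j : ℝ) + 1) :=
      mul_nonneg (add_nonneg (add_nonneg ha0 zero_le_one) hC₉'0) (by positivity)
    have hid' : (a + 1 + C₇' * C₈' + C₉') * ((j : ℝ) + 2) -
        (a + 1 + ((j : ℝ) + 2) * C₇' * C₈' + C₉') = (a + 1 + C₉') * ((j : ℝ) + 1) := by ring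
    linarith [hx', hid']
  calc (a + 1 + b + C₉') * (E₁ + E₂ + E₃) * Q = (a + 1 + b + C₉') * ((E₁ + E₂ + E₃) * Q) := by ring
    _ ≤ ((a + 1 + C₇' * C₈' + C₉') * ((j : ℝ) + 2)) * ((E₁ + E₂ + E₃) * Q) :=
        mul_le_mul_of_nonneg_right hconst hS0
    _ = _ := by ring

/-- **Lemma 12, uniformly in `k`, DISCHARGED** (fundamental lemma = `fundamental_lemma_uniform_holds`).
[cite: FriedlanderIwaniecPisa1978, Lemma 12 and Lemma 26] -/
theorem FI1978_lemma12_uniform (A : SieveSequence) (H : ℝ) (hA : A.IsBombieriSequence)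
    (hH : A.HasDensityConstant H) :
    ∃ η : ℝ, 0 < η ∧ ∃ C : ℝ, ∀ ε : ℝ, 0 < ε → ∃ c₀ : ℝ, 0 < c₀ ∧ ∀ᶠ x : ℝ in atTop,
      ∀ k : ℕ, 2 ≤ k → ∀ s : ℝ, 2 ≤ s → Real.exp s ≤ c₀ * Real.log x → ∀ y z : ℝ,
      2 ≤ z → 1 ≤ y → z ^ s * y ≤ x ^ (1 - ε) →
        |BombieriSieve.sigma1 A k x y z - H * A.size x * BombieriSieve.mainTermF k x y z| ≤
          C * k * (Real.exp (-s) * A.size x * Real.log x ^ (k - 1) +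
                (∫ t in (1 : ℝ)..x, A.size t / t) * Real.log x ^ (k - 2) +
                z ^ (-η) * A.size x * Real.log x ^ k) *
            (Real.log x / Real.log z) ^ 2 :=
  FI1978_lemma12_uniform_of_fundamentalLemma SieveSequence.fundamental_lemma_uniform_holds A H hA hH

end BombieriSieve

end Literature.NumberTheory.Sieve
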